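import Literature.Computability.AlgebraicComplexity.SmallFormatMatMulRank
import Literature.Computability.AlgebraicComplexity.SmallFormatRank
import Literature.Computability.AlgebraicComplexity.TwoByTwoRankLowerBound
import Literature.Computability.AlgebraicComplexity.SmallFormatRankLaderman
import Literature.Computability.AlgebraicComplexity.SmallFormatRankProofs
import HarnessLib

/-!
# `R(⟨2,2,2⟩) = 7` and `19 ≤ R(⟨3,3,3⟩) ≤ 23` over `ℂ` — discharge of the Landsberg 2017 named facts

Sibling proof file of `SmallFormatMatMulRank.lean`: it discharges the named fact
`LandsbergGCT2017_tensorRank_matMulTensor_two` (`tensorRank (matMulTensor ℂ 2 2 2) = 7`;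
Landsberg, *Geometry and Complexity Theory* (2017), §1.1.14, p. 20: "For `n = 2`, we will see
that `R̲(M⟨2⟩) = R(M⟨2⟩) = 7`") as `LandsbergGCT2017_tensorRank_matMulTensor_two_holds`, from

* Strassen's decomposition, `tensorRank_matMulTensor_two_le_seven` (`SmallFormatRank.lean`,
  proved over every commutative ring), and
* the lower bound `seven_le_tensorRank_matMulTensor_two` over every field
  (`TwoByTwoRankLowerBound.lean`: Winograd 1971, Thm. 3.1 / Hopcroft–Kerr 1971, proved after
  Bürgisser–Clausen–Shokrollahi 1997, Prop. (17.9) and Cor. (17.10)),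

both at `K = ℂ`; and the companion fact `LandsbergGCT2017_tensorRank_matMulTensor_three`
(`19 ≤ R(⟨3,3,3⟩) ≤ 23` over `ℂ`; ibid.: "For `n = 3`, we only know `16 ≤ R̲(M⟨3⟩) ≤ 20` and
`19 ≤ R(M⟨3⟩) ≤ 23`") as `LandsbergGCT2017_tensorRank_matMulTensor_three_holds`, from

* the lower bound `19 ≤ R(⟨3,3,3⟩)` over every field — Bläser 2003, Corollary 9, the named fact
  `blaser2003_cor9` of `SmallFormatRank.lean`, DISCHARGED as `blaser2003_cor9_holds` in
  `SmallFormatRankProofs.lean` (Bläser's proof of Theorem 14, `R(⟨n,m,n⟩) ≥ 2mn + 2n − m − 2`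
  for `m ≥ n ≥ 3`, formalised in the `SmallFormatRank*` proof files: substitution method and
  Extension Lemma, the flag `L_η, Z_η, R` and Lemma 5, Lemma 6 via Krull's height theorem,
  Lemma 7, the moves of §5), and
* the upper bound `R(⟨3,3,3⟩) ≤ 23` over every commutative ring — Laderman 1976, proved by an
  explicit `23`-triad certificate, `tensorRank_matMulTensor_three_le_twentyThree`
  (`SmallFormatRankLaderman.lean`),

both at `K = ℂ`. Also recorded: the window `R(⟨3,3,3⟩) ∈ [19, 23]` over every field,
unconditionally (`tensorRank_matMulTensor_three_mem_Icc'`).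
-/

namespace Literature.Computability.AlgebraicComplexity

/-- **DISCHARGE of `LandsbergGCT2017_tensorRank_matMulTensor_two`**: `R(⟨2,2,2⟩) = 7` over `ℂ`
(Landsberg 2017, §1.1.14, p. 20), as `le_antisymm` of Strassen's upper bound
(`tensorRank_matMulTensor_two_le_seven ℂ`) and the Winograd / Hopcroft–Kerr lower bound
(`seven_le_tensorRank_matMulTensor_two ℂ`). [cite: LandsbergGCT2017, §1.1.14 (p. 20)] -/
theorem LandsbergGCT2017_tensorRank_matMulTensor_two_holds :
    LandsbergGCT2017_tensorRank_matMulTensor_two :=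
  le_antisymm (tensorRank_matMulTensor_two_le_seven ℂ) (seven_le_tensorRank_matMulTensor_two ℂ)

/-- **DISCHARGE of `LandsbergGCT2017_tensorRank_matMulTensor_three`**: `19 ≤ R(⟨3,3,3⟩) ≤ 23`
over `ℂ` (Landsberg 2017, §1.1.14, p. 20: "For `n = 3`, we only know … `19 ≤ R(M⟨3⟩) ≤ 23`"),
as the conjunction of Bläser's lower bound (Bläser 2003, Cor. 9: `blaser2003_cor9_holds ℂ`,
`SmallFormatRankProofs.lean`) and Laderman's upper bound (Laderman 1976:
`tensorRank_matMulTensor_three_le_twentyThree ℂ`, `SmallFormatRankLaderman.lean`).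
[cite: LandsbergGCT2017, §1.1.14 (p. 20)] -/
theorem LandsbergGCT2017_tensorRank_matMulTensor_three_holds :
    LandsbergGCT2017_tensorRank_matMulTensor_three := by
  unfold LandsbergGCT2017_tensorRank_matMulTensor_three
  exact ⟨blaser2003_cor9_holds ℂ, tensorRank_matMulTensor_three_le_twentyThree ℂ⟩

/-- The `3 × 3` window `R(⟨3,3,3⟩) ∈ [19, 23]` over every field, unconditionally (Bläser 2003,
Cor. 9, discharged, and Laderman 1976): `tensorRank_matMulTensor_three_mem_Icc` of
`SmallFormatRankLaderman.lean` fed with `blaser2003_cor9_holds`.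
[cite: Blaser2003, Corollary 9] [cite: Laderman1976, p. 126] -/
theorem tensorRank_matMulTensor_three_mem_Icc' (K : Type) [Field K] :
    tensorRank (matMulTensor K 3 3 3) ∈ Set.Icc 19 23 :=
  tensorRank_matMulTensor_three_mem_Icc blaser2003_cor9_holds K

end Literature.Computability.AlgebraicComplexity
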